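import Summits.CriticalPhenomena.PercolationContinuityZ3.Theorems.PercNearOneGluingNoHeavyLowerTailCILReduction
import Literature.Probability.Percolation.KozmaNitzanClusterPropertyReal
import HarnessLib

/-!
# `NoHeavyLowerTail` (stmt-CriticalPhenomena-4575) — the MEAN CONDITIONAL ISOLATION inequality closes the crux

Helper file (`--supports stmt-CriticalPhenomena-4575`; written by the literature seat prim-cplus-literature gen 18/20, 2026-08-19, memo
`run/shared/lean/prim/prim-cplus-literature/MCC-FIRSTMOMENT.md`; landed verbatim by prover prim-ineq-gen-5 gen 23 — the crux itself is
meanwhile proved unconditionally (`CSH.noHeavyLowerTail_holds`, p205010); what this file adds are the EXPLICIT-CONSTANT fat-minority bounds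
`P(1 ≤ N_o ∧ 2N_o ≤ |A|) ≤ 2η` from the first-moment principle and, hypothesis-free, on Kozma–Nitzan's Theorem-7/8 classes).  For bond percolation
`μ = prodBernoulli w` on `Fin n`, a relay set `A`, an observer `o` and a vertex `x` write
`N_x = |{a ∈ A : x ↔ a}|` (so `N_a ≥ 1` for `a ∈ A`), `U = {o ↔ A} = {N_o ≥ 1}` and
`m_x = E N_x = Σ_{a ∈ A} P(x ↔ a)`.  The MEAN CONDITIONAL ISOLATION inequality ("MCC") is the
first-moment maximum principle

  `MCC :  E[N_o | o ↔ A] ≥ min_{a ∈ A} m_a`,  i.e.  `Σ_a P(o ↔ a) ≥ P(o ↔ A) · min_{a ∈ A} Σ_{a'} P(a ↔ a')`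

("given that the observer touches the relay set, it sees on average at least as many relays as the
mean-loneliest relay does").  It is Harris' inequality for `|A| = 2`, the Kozma–Nitzan `|A| = 3` exchange
inequality (= the tree's level-one champion stability) for `|A| = 3`, a consequence of Kozma–Nitzan's
Conjecture 1 (post-FKG) applied with a ghost target (memo §2), and has 0 violations in the gen-18 censuses.
This file PROVES, hypothesis-free in `|A|` and with constant 2, that MCC implies the crux:

* `fatMinority_le_two_mul_of_mean` — if some relay `a` has `m_a · P(U) ≤ E N_o` and `P(a ↮ a') ≤ η` on `A`,
  then `P(1 ≤ N_o ∧ 2 N_o ≤ |A|) ≤ 2η` (Markov on `|A| − N_o` under `U`: `E[|A| − N_o ; U] ≤ P(U)(|A| − m_a) ≤ |A| η`).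
* `fatMinorityLinear_of_meanConditionalIsolation` — MCC ⇒ `stub_fatMinorityLinear` shape (`d₀ = 0`, `C = 2`).
* `noHeavyLowerTail_of_meanConditionalIsolation` — MCC ⇒ `NoHeavyLowerTail`, through the landed
  `noHeavyLowerTail_of_fatMinorityLinear`.

The hypothesis is stated with the minimum realised by SOME relay (`∃ a ∈ A, m_a · P(U) ≤ E N_o`), for
nonempty `A` and `o ∉ A` (for `o ∈ A` it is trivial).  Nothing here asserts MCC in general.

v2 (06:4xZ, after the tree landing p184091 + its mean-form append): MCC IS A TREE THEOREM on Kozma–Nitzan's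
two classes — `Literature.Probability.Percolation.KozmaNitzan2024_thm8_meanRelayCount` (observer joined only
to relays; KN Thm. 8 for the monotone cluster property `f = |C ∩ A|`, combined with Harris) and
`KozmaNitzan2024_thm7_meanRelayCount` (`|A| = 2`, KN Thm. 7).  Hence, HYPOTHESIS-FREE:

* `fatMinority_relayAdjacent` — if `o` is joined only to relays (`w s(o,u) = 0` for `u ∉ A`, `u ≠ o`) and
  `P(a ↮ a') ≤ η` on `A`, then `P(1 ≤ N_o ∧ 2 N_o ≤ |A|) ≤ 2η` — the pointwise content of the crux
  (`stub_fatMinorityLinear` with `d₀ = 0`, `C = 2`, even without the `P(o ↮ A)` term) on KN's Theorem-8 class.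
* `fatMinority_card_two` — the same for `|A| = 2`.
-/

noncomputable section

namespace Summit.CriticalPhenomena.PercolationContinuityZ3.Theorems

open MeasureTheory Set Literature.Probability.LatticeModels Literature.Probability.Percolation
open Summit.CriticalPhenomena.PercolationContinuityZ3.Theses.PercNearOneGluing
open scoped Classical BigOperators

/-- **Markov under `U` from the mean hypothesis.**  If `a ∈ A`, `P(a ↮ a') ≤ η` for every `a' ∈ A`, and the
mean hypothesis `m_a · P(o ↔ A) ≤ Σ_{x ∈ A} P(o ↔ x)` holds, then `P(1 ≤ N_o ∧ 2 N_o ≤ |A|) ≤ 2η`: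
on the event at least `|A|/2` relays are missed by `o` while `o ↔ A`, and the expected number of relays
missed by `o` on `{o ↔ A}` is `|A| P(U) − E N_o ≤ P(U) (|A| − m_a) ≤ |A| η`. -/
theorem fatMinority_le_two_mul_of_mean {n : ℕ} (w : Sym2 (Fin n) → unitInterval) (A : Finset (Fin n))
    (o a : Fin n) (η : ℝ) (ha : a ∈ A)
    (hpair : ∀ a' ∈ A, (prodBernoulli w).real (openConn a a' : Set (BondConfig (Fin n)))ᶜ ≤ η)
    (hmean : (∑ x ∈ A, (prodBernoulli w).real (openConn a x : Set (BondConfig (Fin n)))) *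
        (prodBernoulli w).real (⋃ x ∈ A, (openConn o x : Set (BondConfig (Fin n)))) ≤
      ∑ x ∈ A, (prodBernoulli w).real (openConn o x : Set (BondConfig (Fin n)))) :
    (prodBernoulli w).real {ω : BondConfig (Fin n) |
        1 ≤ (A.filter fun x => ω ∈ openConn o x).card ∧
          2 * (A.filter fun x => ω ∈ openConn o x).card ≤ A.card} ≤ 2 * η := by
  have hmeas : ∀ s : Set (BondConfig (Fin n)), MeasurableSet s :=
    fun _ => MeasurableSet.of_discrete
  set P := prodBernoulli w with hP
  set D : Set (BondConfig (Fin n)) := {ω : BondConfig (Fin n) |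
      1 ≤ (A.filter fun x => ω ∈ openConn o x).card ∧
        2 * (A.filter fun x => ω ∈ openConn o x).card ≤ A.card} with hD
  set U : Set (BondConfig (Fin n)) := ⋃ x ∈ A, (openConn o x : Set (BondConfig (Fin n))) with hU
  set m : ℝ := (A.card : ℝ) with hm
  have hmpos : 0 < m := by rw [hm]; exact_mod_cast Finset.card_pos.2 ⟨a, ha⟩
  -- (1) counting: on `D`, at least `m/2` relays are not joined to `o`
  have hcount : m / 2 * P.real D ≤
      ∑ x ∈ A, P.real (D ∩ (openConn o x : Set (BondConfig (Fin n)))ᶜ) := by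
    refine halfLeSevenForms_mul_measureReal_le_sum_inter P A
      (fun x => (openConn o x : Set (BondConfig (Fin n)))ᶜ) (fun _ _ => hmeas _) (hmeas D)
      (m / 2) fun ω hω => ?_
    have hind : ∀ x ∈ A,
        ((openConn o x : Set (BondConfig (Fin n)))ᶜ).indicator (fun _ => (1 : ℝ)) ω =
          if ¬ ω ∈ (openConn o x : Set (BondConfig (Fin n))) then (1 : ℝ) else 0 := by
      intro x _
      by_cases h' : ω ∈ (openConn o x : Set (BondConfig (Fin n)))
      · rw [if_neg (not_not.2 h'), Set.indicator_of_notMem (Set.notMem_compl_iff.2 h')]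
      · rw [if_pos h', Set.indicator_of_mem (show ω ∈ (openConn o x : Set (BondConfig (Fin n)))ᶜ
          from h')]
    rw [Finset.sum_congr rfl hind, Finset.sum_boole]
    have hhalf : 2 * (A.filter fun x => ω ∈ (openConn o x : Set (BondConfig (Fin n)))).card ≤
        A.card := hω.2
    have hsplit := Finset.card_filter_add_card_filter_not (s := A)
      (fun x => ω ∈ (openConn o x : Set (BondConfig (Fin n))))
    have hcast : ((A.filter fun x => ω ∈ (openConn o x : Set (BondConfig (Fin n)))).card : ℝ) +
        ((A.filter fun x => ¬ ω ∈ (openConn o x : Set (BondConfig (Fin n)))).card : ℝ) = m := by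
      rw [hm]; exact_mod_cast hsplit
    have hhalf' : 2 * ((A.filter fun x => ω ∈ (openConn o x : Set (BondConfig (Fin n)))).card : ℝ)
        ≤ m := by
      rw [hm]; exact_mod_cast hhalf
    linarith
  -- (2) `D ⊆ U` and `openConn o x ⊆ U` for `x ∈ A`
  have hDU : D ⊆ U := by
    intro ω hω
    have h1 : 1 ≤ (A.filter fun x => ω ∈ (openConn o x : Set (BondConfig (Fin n)))).card := hω.1
    obtain ⟨x, hx⟩ := Finset.card_pos.1 h1
    obtain ⟨hxA, hox⟩ := Finset.mem_filter.1 hx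
    rw [hU]
    exact Set.mem_biUnion hxA hox
  have hxU : ∀ x ∈ A, (openConn o x : Set (BondConfig (Fin n))) ⊆ U := by
    intro x hx ω hω
    rw [hU]
    exact Set.mem_biUnion hx hω
  -- (3) each term: `P(D ∩ {o ↮ x}) ≤ P(U) − P(o ↔ x)`
  have hterm : ∀ x ∈ A, P.real (D ∩ (openConn o x : Set (BondConfig (Fin n)))ᶜ) ≤
      P.real U - P.real (openConn o x : Set (BondConfig (Fin n))) := by
    intro x hx
    have hsub : D ∩ (openConn o x : Set (BondConfig (Fin n)))ᶜ ⊆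
        U \ (openConn o x : Set (BondConfig (Fin n))) := by
      intro ω hω
      exact ⟨hDU hω.1, hω.2⟩
    calc P.real (D ∩ (openConn o x : Set (BondConfig (Fin n)))ᶜ)
        ≤ P.real (U \ (openConn o x : Set (BondConfig (Fin n)))) :=
          measureReal_mono hsub (measure_ne_top _ _)
      _ = P.real U - P.real (openConn o x : Set (BondConfig (Fin n))) :=
          measureReal_sdiff (hxU x hx) (hmeas _) (measure_ne_top _ _)
  -- (4) the mean deficit of `a`: `m − m_a = Σ_x P(a ↮ x) ≤ m η`
  have hcompl : ∀ x ∈ A, P.real (openConn a x : Set (BondConfig (Fin n)))ᶜ =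
      1 - P.real (openConn a x : Set (BondConfig (Fin n))) := by
    intro x _
    rw [measureReal_compl (hmeas _), hP, probReal_univ]
  have hdef : m - ∑ x ∈ A, P.real (openConn a x : Set (BondConfig (Fin n))) ≤ m * η := by
    have h1 : m - ∑ x ∈ A, P.real (openConn a x : Set (BondConfig (Fin n))) =
        ∑ x ∈ A, P.real (openConn a x : Set (BondConfig (Fin n)))ᶜ := by
      rw [Finset.sum_congr rfl hcompl, Finset.sum_sub_distrib, Finset.sum_const, nsmul_eq_mul,
        mul_one, hm]
    rw [h1]
    calc ∑ x ∈ A, P.real (openConn a x : Set (BondConfig (Fin n)))ᶜ ≤ ∑ x ∈ A, η :=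
          Finset.sum_le_sum fun x hx => hpair x hx
      _ = m * η := by rw [Finset.sum_const, nsmul_eq_mul, hm]
  -- (5) assemble
  have hUle : P.real U ≤ 1 := by
    rw [hP]; exact measureReal_le_one
  have hUnn : 0 ≤ P.real U := measureReal_nonneg
  have hsum : ∑ x ∈ A, P.real (D ∩ (openConn o x : Set (BondConfig (Fin n)))ᶜ) ≤
      m * P.real U - ∑ x ∈ A, P.real (openConn o x : Set (BondConfig (Fin n))) := by
    calc ∑ x ∈ A, P.real (D ∩ (openConn o x : Set (BondConfig (Fin n)))ᶜ)
        ≤ ∑ x ∈ A, (P.real U - P.real (openConn o x : Set (BondConfig (Fin n)))) :=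
          Finset.sum_le_sum fun x hx => hterm x hx
      _ = m * P.real U - ∑ x ∈ A, P.real (openConn o x : Set (BondConfig (Fin n))) := by
          rw [Finset.sum_sub_distrib, Finset.sum_const, nsmul_eq_mul, hm]
  have hmean' : (∑ x ∈ A, P.real (openConn a x : Set (BondConfig (Fin n)))) * P.real U ≤
      ∑ x ∈ A, P.real (openConn o x : Set (BondConfig (Fin n))) := by
    rw [hP, hU]; exact hmean
  have hηnn : 0 ≤ η := by
    have h0 : (0 : ℝ) ≤ P.real (openConn a a : Set (BondConfig (Fin n)))ᶜ := measureReal_nonneg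
    exact h0.trans (hpair a ha)
  -- `m/2 · P(D) ≤ m P(U) − E N_o ≤ P(U) (m − m_a) ≤ P(U) m η ≤ m η`
  have hkey : m / 2 * P.real D ≤ m * η := by
    have h1 : m * P.real U - ∑ x ∈ A, P.real (openConn o x : Set (BondConfig (Fin n))) ≤
        P.real U * (m - ∑ x ∈ A, P.real (openConn a x : Set (BondConfig (Fin n)))) := by
      nlinarith
    have h2 : P.real U * (m - ∑ x ∈ A, P.real (openConn a x : Set (BondConfig (Fin n)))) ≤
        P.real U * (m * η) := mul_le_mul_of_nonneg_left hdef hUnn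
    have h3 : P.real U * (m * η) ≤ 1 * (m * η) :=
      mul_le_mul_of_nonneg_right hUle (by positivity)
    linarith [hcount, hsum]
  have h2 : m / 2 * P.real D ≤ m / 2 * (2 * η) := by
    calc m / 2 * P.real D ≤ m * η := hkey
      _ = m / 2 * (2 * η) := by ring
  exact le_of_mul_le_mul_left h2 (by positivity)

/-- **MCC ⇒ the fat-minority linear bound (`d₀ = 0`, `C = 2`).**  If for every finite weighted graph, every
nonempty relay set `A` and every observer `o ∉ A` some relay `a ∈ A` satisfies the mean inequality
`m_a · P(o ↔ A) ≤ E N_o` (this holds for the mean-loneliest relay under MCC), then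
`P(0 < N ∧ 2N ≤ |A|) ≤ 2 (P(o ↮ A) + η)` whenever all pairwise relay disconnections are `≤ η`. -/
theorem fatMinorityLinear_of_meanConditionalIsolation
    (hMCC : ∀ (n : ℕ) (w : Sym2 (Fin n) → unitInterval) (A : Finset (Fin n)) (o : Fin n),
      A.Nonempty → o ∉ A → ∃ a ∈ A,
        (∑ x ∈ A, (prodBernoulli w).real (openConn a x : Set (BondConfig (Fin n)))) *
            (prodBernoulli w).real (⋃ x ∈ A, (openConn o x : Set (BondConfig (Fin n)))) ≤
          ∑ x ∈ A, (prodBernoulli w).real (openConn o x : Set (BondConfig (Fin n)))) :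
    ∃ (d₀ : ℕ) (C : ℝ), 0 ≤ C ∧ ∀ (n : ℕ) (w : Sym2 (Fin n) → unitInterval) (A : Finset (Fin n))
      (o : Fin n) (η : ℝ), 0 ≤ η → o ∉ A →
      (∀ a ∈ A, ∀ a' ∈ A, (Literature.Probability.LatticeModels.prodBernoulli w).real
        (Literature.Probability.Percolation.openConn a a')ᶜ ≤ η) →
      (Literature.Probability.LatticeModels.prodBernoulli w).real
          {ω : Literature.Probability.Percolation.BondConfig (Fin n) |
            d₀ < (A.filter fun a => ω ∈ Literature.Probability.Percolation.openConn o a).card ∧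
              2 * (A.filter fun a => ω ∈ Literature.Probability.Percolation.openConn o a).card ≤
                A.card} ≤
        C * ((Literature.Probability.LatticeModels.prodBernoulli w).real
          (⋃ a ∈ A, Literature.Probability.Percolation.openConn o a)ᶜ + η) := by
  refine ⟨0, 2, by norm_num, fun n w A o η hη ho hpair => ?_⟩
  have hcompl : 0 ≤ (prodBernoulli w).real (⋃ a ∈ A, (openConn o a : Set (BondConfig (Fin n))))ᶜ :=
    measureReal_nonneg
  rcases A.eq_empty_or_nonempty with hAe | hAne
  · have hempty : {ω : BondConfig (Fin n) |
        0 < (A.filter fun a => ω ∈ openConn o a).card ∧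
          2 * (A.filter fun a => ω ∈ openConn o a).card ≤ A.card} = ∅ := by
      ext ω
      simp [hAe]
    rw [hempty, measureReal_empty]
    nlinarith
  · obtain ⟨a, ha, hle⟩ := hMCC n w A o hAne ho
    have h2 := fatMinority_le_two_mul_of_mean w A o a η ha (fun a' ha' => hpair a ha a' ha') hle
    have hev : {ω : BondConfig (Fin n) |
        0 < (A.filter fun a => ω ∈ openConn o a).card ∧
          2 * (A.filter fun a => ω ∈ openConn o a).card ≤ A.card} =
        {ω : BondConfig (Fin n) |
          1 ≤ (A.filter fun x => ω ∈ openConn o x).card ∧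
            2 * (A.filter fun x => ω ∈ openConn o x).card ≤ A.card} := by
      ext ω; simp only [Set.mem_setOf_eq]; omega
    rw [hev]
    linarith

/-- **The mean conditional isolation inequality closes the crux `NoHeavyLowerTail`** (through the landed
`noHeavyLowerTail_of_fatMinorityLinear`, `d₀ = 0`, `C = 2`).  MCC itself — `E[N_o | o ↔ A] ≥ min_a E N_a` —
is NOT proved here; it is Harris for `|A| = 2`, Kozma–Nitzan's `|A| = 3` theorem, and follows from
Kozma–Nitzan Conjecture 1 with a ghost target (memo MCC-FIRSTMOMENT.md §2). -/
theorem noHeavyLowerTail_of_meanConditionalIsolation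
    (hMCC : ∀ (n : ℕ) (w : Sym2 (Fin n) → unitInterval) (A : Finset (Fin n)) (o : Fin n),
      A.Nonempty → o ∉ A → ∃ a ∈ A,
        (∑ x ∈ A, (prodBernoulli w).real (openConn a x : Set (BondConfig (Fin n)))) *
            (prodBernoulli w).real (⋃ x ∈ A, (openConn o x : Set (BondConfig (Fin n)))) ≤
          ∑ x ∈ A, (prodBernoulli w).real (openConn o x : Set (BondConfig (Fin n)))) :
    Summit.CriticalPhenomena.PercolationContinuityZ3.Theses.PercNearOneGluing.NoHeavyLowerTail :=
  noHeavyLowerTail_of_fatMinorityLinear (fatMinorityLinear_of_meanConditionalIsolation hMCC)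

/-- **The fat-minority bound, hypothesis-free, for an observer joined only to relays** (Kozma–Nitzan's
Theorem-8 class): `P(1 ≤ N_o ∧ 2 N_o ≤ |A|) ≤ 2η` whenever all pairwise relay disconnections are `≤ η`.
From the tree theorem `KozmaNitzan2024_thm8_meanRelayCount` (MCC on this class) and
`fatMinority_le_two_mul_of_mean`. -/
theorem fatMinority_relayAdjacent {n : ℕ} (w : Sym2 (Fin n) → unitInterval) (A : Finset (Fin n))
    (o : Fin n) (η : ℝ) (hA : A.Nonempty) (hiso : ∀ u, u ≠ o → u ∉ A → w s(o, u) = 0)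
    (hpair : ∀ a ∈ A, ∀ a' ∈ A, (prodBernoulli w).real (openConn a a' : Set (BondConfig (Fin n)))ᶜ ≤ η) :
    (prodBernoulli w).real {ω : BondConfig (Fin n) |
        1 ≤ (A.filter fun x => ω ∈ openConn o x).card ∧
          2 * (A.filter fun x => ω ∈ openConn o x).card ≤ A.card} ≤ 2 * η := by
  obtain ⟨a, ha, hmean⟩ := Literature.Probability.Percolation.KozmaNitzan2024_thm8_meanRelayCount w A o hA hiso
  exact fatMinority_le_two_mul_of_mean w A o a η ha (hpair a ha) hmean

/-- **The fat-minority bound, hypothesis-free, for `|A| = 2`** (Kozma–Nitzan's Theorem-7 class). -/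
theorem fatMinority_card_two {n : ℕ} (w : Sym2 (Fin n) → unitInterval) (A : Finset (Fin n))
    (o : Fin n) (η : ℝ) (hA : A.card = 2)
    (hpair : ∀ a ∈ A, ∀ a' ∈ A, (prodBernoulli w).real (openConn a a' : Set (BondConfig (Fin n)))ᶜ ≤ η) :
    (prodBernoulli w).real {ω : BondConfig (Fin n) |
        1 ≤ (A.filter fun x => ω ∈ openConn o x).card ∧
          2 * (A.filter fun x => ω ∈ openConn o x).card ≤ A.card} ≤ 2 * η := by
  obtain ⟨a, ha, hmean⟩ := Literature.Probability.Percolation.KozmaNitzan2024_thm7_meanRelayCount w A o hA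
  exact fatMinority_le_two_mul_of_mean w A o a η ha (hpair a ha) hmean

end Summit.CriticalPhenomena.PercolationContinuityZ3.Theorems
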